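import Summits.AnomalousDissipation.AnomalousDissipation.Theorems.ScalarAnomalySteadySourceFormal.Negative.ShearFlux

/-!
# Negative knowledge for the crux `ScalarAnomalySteadySourceFormal` (stmt-AnomalousDissipation-0448), VIII-a:
# boundary flux of a square band under GENERAL band-limited stirring

Certified copy of §10.1 of the cdisprove work file.  The shear–drift no-go (§9, `Negative.Shear*`)
used that axis-supported stirring conserves the sector `p 1`.  For a general finite set of stirring
modes `S ⊆ {|k 0| ≤ R, |k 1| ≤ R}` (cellular flows, any Galerkin truncation of a planar flow) the
transport shifts both indices, so bands are built from SQUARE boxes `sbox K = box K K` and square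
layers `K - R < |p|_∞ ≤ K + R`; the transversal weight is now `|p · c_k| ≤ (|p 0| + |p 1|) ‖c_k‖ ≤ 2|p|_∞ M`,
i.e. the flux through `|p|_∞ = K` carries the factor `K + R` (Batchelor's exponential stretching; only
a logarithm will be gained downstream):
`‖bdryFlux S (sbox K' \\ sbox K) c Y‖ ≤ 4 · #S · M · ((K+R) · innerSqLayerSum + (K'+R) · outerSqLayerSum)`
(`norm_bdryFlux_cell_le`).

Supports stmt-AnomalousDissipation-0448 (the band-limited no-go, files `Cell*`).
-/

set_option linter.dupNamespace false

noncomputable section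

open scoped BigOperators Topology ENNReal NNReal InnerProductSpace ContDiff
open Filter Set Function MeasureTheory UnitAddTorus Complex

namespace Summit.AnomalousDissipation.AnomalousDissipation.Theorems.ScalarAnomalySteadySourceFormal.Negative

open Literature.Analysis
open Literature.Analysis.FunctionSpaces Literature.Analysis.FunctionSpaces.Torus
open Literature.Analysis.FluidPDE Literature.Analysis.FluidPDE.Torus

/-- The frequency lattice `ℤ²` (local notation). -/
local notation "ℤ²" => Fin 2 → ℤ

section SquareLayers

/-- The square layer `lo < |p|_∞ ≤ hi` (as `(lo < |p 0| ∨ lo < |p 1|) ∧ p ∈ box hi hi`). [folklore] -/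
def slayer (lo hi : ℤ) : Finset ℤ² :=
  (box hi hi).filter fun p => lo < |p 0| ∨ lo < |p 1|

/-- Membership in a square layer. [folklore] -/
theorem mem_slayer {lo hi : ℤ} {p : ℤ²} : p ∈ slayer lo hi ↔ (|p 0| ≤ hi ∧ |p 1| ≤ hi) ∧ (lo < |p 0| ∨ lo < |p 1|) := by
  simp only [slayer, Finset.mem_filter, mem_box]

/-- The sum of `‖Y p‖²` over a square layer. [folklore] -/
def slayerSum (lo hi : ℤ) (Y : ℤ² → ℂ) : ℝ :=
  ∑ p ∈ slayer lo hi, ‖Y p‖ ^ 2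

/-- `slayerSum ≥ 0`. [folklore] -/
theorem slayerSum_nonneg (lo hi : ℤ) (Y : ℤ² → ℂ) : 0 ≤ slayerSum lo hi Y :=
  Finset.sum_nonneg fun _ _ => sq_nonneg _

/-- `‖p · w‖ ≤ (|p 0| + |p 1|) ‖w‖`. [folklore] -/
theorem norm_zdot_le_add (w : EuclideanSpace ℂ (Fin 2)) (p : ℤ²) :
    ‖zdot p w‖ ≤ (|(p 0 : ℝ)| + |(p 1 : ℝ)|) * ‖w‖ := by
  simp only [zdot, Fin.sum_univ_two]
  refine (norm_add_le _ _).trans ?_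
  rw [norm_mul, norm_mul, Complex.norm_intCast, Complex.norm_intCast, add_mul]
  exact add_le_add (mul_le_mul_of_nonneg_left (PiLp.norm_apply_le w 0) (abs_nonneg _))
    (mul_le_mul_of_nonneg_left (PiLp.norm_apply_le w 1) (abs_nonneg _))

end SquareLayers

section CellFluxBound

variable {S : Finset ℤ²} {R : ℕ} {M : ℝ} {cc : ℤ² → EuclideanSpace ℂ (Fin 2)}

/-- **Core square-layer estimate.**  For a shift `m` with `|m 0|, |m 1| ≤ R` and a vector `w` with
`‖w‖ ≤ M`, the one-sided boundary interactions of the band `sbox K' \\ sbox K` are bounded by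
`2M ((K+R) · innerSqLayerSum + (K'+R) · outerSqLayerSum)`. [folklore] -/
theorem cell_sum_boundary_le {K K' : ℤ} (hK : 0 ≤ K) (hK' : 0 ≤ K') {m : ℤ²} (hm0 : |m 0| ≤ R) (hm1 : |m 1| ≤ R)
    {w : EuclideanSpace ℂ (Fin 2)} (hwM : ‖w‖ ≤ M) (hM : 0 ≤ M) (Y : ℤ² → ℂ) :
    ∑ p ∈ box K' K' \ box K K,
        (if p - m ∈ box K' K' \ box K K then 0 else ‖zdot p w * Y (p - m) * (starRingEnd ℂ) (Y p)‖) ≤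
      2 * M * ((K + R) * slayerSum (K - R) (K + R) Y + (K' + R) * slayerSum (K' - R) (K' + R) Y) := by
  set 𝔅 := box K' K' \ box K K with h𝔅
  have hR0 : (0 : ℤ) ≤ R := Int.natCast_nonneg R
  -- pointwise bound by the two cases
  have hpt : ∀ p ∈ 𝔅, (if p - m ∈ 𝔅 then 0 else ‖zdot p w * Y (p - m) * (starRingEnd ℂ) (Y p)‖) ≤
      (if p - m ∈ box K K then 2 * M * (K + R) * ((‖Y (p - m)‖ ^ 2 + ‖Y p‖ ^ 2) / 2) else 0) +
      (if p - m ∉ box K' K' then 2 * M * (K' + R) * ((‖Y (p - m)‖ ^ 2 + ‖Y p‖ ^ 2) / 2) else 0) := by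
    intro p hp
    have hp' := hp
    simp only [h𝔅, Finset.mem_sdiff, mem_box] at hp'
    have hprod : ‖zdot p w * Y (p - m) * (starRingEnd ℂ) (Y p)‖ ≤
        (|(p 0 : ℝ)| + |(p 1 : ℝ)|) * M * ((‖Y (p - m)‖ ^ 2 + ‖Y p‖ ^ 2) / 2) := by
      rw [norm_mul, norm_mul, Complex.norm_conj]
      have h2 : ‖Y (p - m)‖ * ‖Y p‖ ≤ (‖Y (p - m)‖ ^ 2 + ‖Y p‖ ^ 2) / 2 := by
        nlinarith [sq_nonneg (‖Y (p - m)‖ - ‖Y p‖), norm_nonneg (Y (p - m)), norm_nonneg (Y p)]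
      calc ‖zdot p w‖ * ‖Y (p - m)‖ * ‖Y p‖ = ‖zdot p w‖ * (‖Y (p - m)‖ * ‖Y p‖) := by ring
        _ ≤ ((|(p 0 : ℝ)| + |(p 1 : ℝ)|) * M) * ((‖Y (p - m)‖ ^ 2 + ‖Y p‖ ^ 2) / 2) := by
            refine mul_le_mul ((norm_zdot_le_add w p).trans (by gcongr)) h2 (by positivity) (by positivity)
        _ = (|(p 0 : ℝ)| + |(p 1 : ℝ)|) * M * ((‖Y (p - m)‖ ^ 2 + ‖Y p‖ ^ 2) / 2) := by ring
    have hp0' : |(p 0 : ℝ)| ≤ K' := by have := hp'.1.1; exact_mod_cast this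
    have hp1' : |(p 1 : ℝ)| ≤ K' := by have := hp'.1.2; exact_mod_cast this
    have h0 : 0 ≤ (‖Y (p - m)‖ ^ 2 + ‖Y p‖ ^ 2) / 2 := by positivity
    have hK'R : (0 : ℝ) ≤ K' + R := by positivity
    have hKR : (0 : ℝ) ≤ K + R := by positivity
    by_cases hq : p - m ∈ 𝔅
    · rw [if_pos hq]
      exact add_nonneg (by split_ifs <;> positivity) (by split_ifs <;> positivity)
    rw [if_neg hq]
    by_cases hA : p - m ∈ box K K
    · rw [if_pos hA]
      have hq0 := (mem_box.1 hA).1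
      have hq1 := (mem_box.1 hA).2
      simp only [Pi.sub_apply] at hq0 hq1
      have hp0 : |(p 0 : ℝ)| ≤ K + R := by
        have h1 := abs_sub_abs_le_abs_sub (p 0) (m 0)
        have : |p 0| ≤ K + R := by omega
        exact_mod_cast this
      have hp1 : |(p 1 : ℝ)| ≤ K + R := by
        have h1 := abs_sub_abs_le_abs_sub (p 1) (m 1)
        have : |p 1| ≤ K + R := by omega
        exact_mod_cast this
      refine le_add_of_le_of_nonneg (hprod.trans ?_) (by split_ifs <;> positivity)
      calc (|(p 0 : ℝ)| + |(p 1 : ℝ)|) * M * ((‖Y (p - m)‖ ^ 2 + ‖Y p‖ ^ 2) / 2)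
          ≤ ((K + R) + (K + R)) * M * ((‖Y (p - m)‖ ^ 2 + ‖Y p‖ ^ 2) / 2) := by gcongr
        _ = 2 * M * (K + R) * ((‖Y (p - m)‖ ^ 2 + ‖Y p‖ ^ 2) / 2) := by ring
    · have hB : p - m ∉ box K' K' := fun h' => hq (Finset.mem_sdiff.2 ⟨h', hA⟩)
      rw [if_neg hA, if_pos hB, zero_add]
      refine hprod.trans ?_
      calc (|(p 0 : ℝ)| + |(p 1 : ℝ)|) * M * ((‖Y (p - m)‖ ^ 2 + ‖Y p‖ ^ 2) / 2)
          ≤ ((K' + R) + (K' + R)) * M * ((‖Y (p - m)‖ ^ 2 + ‖Y p‖ ^ 2) / 2) := by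
            gcongr
            · linarith [show (0:ℝ) ≤ R from by exact_mod_cast R.zero_le]
            · linarith [show (0:ℝ) ≤ R from by exact_mod_cast R.zero_le]
        _ = 2 * M * (K' + R) * ((‖Y (p - m)‖ ^ 2 + ‖Y p‖ ^ 2) / 2) := by ring
  refine (Finset.sum_le_sum hpt).trans ?_
  rw [Finset.sum_add_distrib]
  -- the inner layer part
  have hinner : ∑ p ∈ 𝔅, (if p - m ∈ box K K then 2 * M * (K + R) * ((‖Y (p - m)‖ ^ 2 + ‖Y p‖ ^ 2) / 2) else 0) ≤
      2 * M * ((K + R) * slayerSum (K - R) (K + R) Y) := by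
    rw [← Finset.sum_filter]
    set A := 𝔅.filter fun p => p - m ∈ box K K with hA
    have hAsub : A ⊆ slayer (K - R) (K + R) := by
      intro p hp
      simp only [hA, h𝔅, Finset.mem_filter, Finset.mem_sdiff, mem_box, Pi.sub_apply, not_and_or, not_le] at hp
      rw [mem_slayer]
      obtain ⟨⟨⟨_, _⟩, hnot⟩, hq0, hq1⟩ := hp
      have h0 := abs_sub_abs_le_abs_sub (p 0) (m 0)
      have h1 := abs_sub_abs_le_abs_sub (p 1) (m 1)
      refine ⟨⟨by omega, by omega⟩, ?_⟩
      rcases hnot with h | h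
      · left; omega
      · right; omega
    have hAimg : A.image (fun p => p - m) ⊆ slayer (K - R) (K + R) := by
      intro q hq
      simp only [Finset.mem_image] at hq
      obtain ⟨p, hp, rfl⟩ := hq
      simp only [hA, h𝔅, Finset.mem_filter, Finset.mem_sdiff, mem_box, Pi.sub_apply, not_and_or, not_le] at hp
      rw [mem_slayer]
      simp only [Pi.sub_apply]
      obtain ⟨⟨⟨_, _⟩, hnot⟩, hq0, hq1⟩ := hp
      have h0 := abs_sub_abs_le_abs_sub (p 0) (m 0)
      have h1 := abs_sub_abs_le_abs_sub (p 1) (m 1)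
      refine ⟨⟨by omega, by omega⟩, ?_⟩
      rcases hnot with h | h
      · left; omega
      · right; omega
    have hinj : Set.InjOn (fun p : ℤ² => p - m) A := fun p _ q _ hpq => sub_left_injective hpq
    have hKR : (0 : ℝ) ≤ K + R := by positivity
    calc ∑ p ∈ A, 2 * M * (K + R) * ((‖Y (p - m)‖ ^ 2 + ‖Y p‖ ^ 2) / 2)
        = M * (K + R) * (∑ p ∈ A, ‖Y (p - m)‖ ^ 2 + ∑ p ∈ A, ‖Y p‖ ^ 2) := by
          rw [← Finset.sum_add_distrib, Finset.mul_sum]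
          exact Finset.sum_congr rfl fun p _ => by ring
      _ ≤ M * (K + R) * (slayerSum (K - R) (K + R) Y + slayerSum (K - R) (K + R) Y) := by
          gcongr
          · rw [← Finset.sum_image (f := fun q => ‖Y q‖ ^ 2) hinj]
            exact Finset.sum_le_sum_of_subset_of_nonneg hAimg fun _ _ _ => sq_nonneg _
          · exact Finset.sum_le_sum_of_subset_of_nonneg hAsub fun _ _ _ => sq_nonneg _
      _ = 2 * M * ((K + R) * slayerSum (K - R) (K + R) Y) := by ring
  -- the outer layer part
  have houter : ∑ p ∈ 𝔅, (if p - m ∉ box K' K' then 2 * M * (K' + R) * ((‖Y (p - m)‖ ^ 2 + ‖Y p‖ ^ 2) / 2) else 0) ≤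
      2 * M * ((K' + R) * slayerSum (K' - R) (K' + R) Y) := by
    rw [← Finset.sum_filter]
    set B := 𝔅.filter fun p => p - m ∉ box K' K' with hB
    have hBsub : B ⊆ slayer (K' - R) (K' + R) := by
      intro p hp
      simp only [hB, h𝔅, Finset.mem_filter, Finset.mem_sdiff, mem_box, Pi.sub_apply, not_and_or, not_le] at hp
      rw [mem_slayer]
      obtain ⟨⟨⟨hp0, hp1⟩, _⟩, hq⟩ := hp
      have h0 := abs_sub (p 0) (m 0)
      have h1 := abs_sub (p 1) (m 1)
      refine ⟨⟨by omega, by omega⟩, ?_⟩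
      rcases hq with h | h
      · left; omega
      · right; omega
    have hBimg : B.image (fun p => p - m) ⊆ slayer (K' - R) (K' + R) := by
      intro q hq
      simp only [Finset.mem_image] at hq
      obtain ⟨p, hp, rfl⟩ := hq
      simp only [hB, h𝔅, Finset.mem_filter, Finset.mem_sdiff, mem_box, Pi.sub_apply, not_and_or, not_le] at hp
      rw [mem_slayer]
      simp only [Pi.sub_apply]
      obtain ⟨⟨⟨hp0, hp1⟩, _⟩, hq⟩ := hp
      have h0 := abs_sub (p 0) (m 0)
      have h1 := abs_sub (p 1) (m 1)
      refine ⟨⟨by omega, by omega⟩, ?_⟩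
      rcases hq with h | h
      · left; omega
      · right; omega
    have hinj : Set.InjOn (fun p : ℤ² => p - m) B := fun p _ q _ hpq => sub_left_injective hpq
    have hK'R : (0 : ℝ) ≤ K' + R := by positivity
    calc ∑ p ∈ B, 2 * M * (K' + R) * ((‖Y (p - m)‖ ^ 2 + ‖Y p‖ ^ 2) / 2)
        = M * (K' + R) * (∑ p ∈ B, ‖Y (p - m)‖ ^ 2 + ∑ p ∈ B, ‖Y p‖ ^ 2) := by
          rw [← Finset.sum_add_distrib, Finset.mul_sum]
          exact Finset.sum_congr rfl fun p _ => by ring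
      _ ≤ M * (K' + R) * (slayerSum (K' - R) (K' + R) Y + slayerSum (K' - R) (K' + R) Y) := by
          gcongr
          · rw [← Finset.sum_image (f := fun q => ‖Y q‖ ^ 2) hinj]
            exact Finset.sum_le_sum_of_subset_of_nonneg hBimg fun _ _ _ => sq_nonneg _
          · exact Finset.sum_le_sum_of_subset_of_nonneg hBsub fun _ _ _ => sq_nonneg _
      _ = 2 * M * ((K' + R) * slayerSum (K' - R) (K' + R) Y) := by ring
  calc _ ≤ 2 * M * ((K + R) * slayerSum (K - R) (K + R) Y) + 2 * M * ((K' + R) * slayerSum (K' - R) (K' + R) Y) :=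
        add_le_add hinner houter
    _ = 2 * M * ((K + R) * slayerSum (K - R) (K + R) Y + (K' + R) * slayerSum (K' - R) (K' + R) Y) := by ring

/-- **Boundary flux bound for the square band** under general band-limited stirring:
`‖bdryFlux‖ ≤ 4 · #S · M · ((K+R) · innerSqLayerSum + (K'+R) · outerSqLayerSum)`. [folklore] -/
theorem norm_bdryFlux_cell_le {K K' : ℤ} (hK : 0 ≤ K) (hK' : 0 ≤ K')
    (hS : ∀ k ∈ S, |k 0| ≤ R ∧ |k 1| ≤ R) (hM : ∀ k, ‖cc k‖ ≤ M) (hM0 : 0 ≤ M) (Y : ℤ² → ℂ) :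
    ‖bdryFlux S (box K' K' \ box K K) cc Y‖ ≤
      4 * S.card * M * ((K + R) * slayerSum (K - R) (K + R) Y + (K' + R) * slayerSum (K' - R) (K' + R) Y) := by
  set 𝔅 := box K' K' \ box K K with h𝔅
  set L : ℝ := 2 * M * ((K + R) * slayerSum (K - R) (K + R) Y + (K' + R) * slayerSum (K' - R) (K' + R) Y) with hL
  have hR0 : (0 : ℝ) ≤ R := by exact_mod_cast R.zero_le
  have hL0 : 0 ≤ L := by
    have := slayerSum_nonneg (K - R) (K + R) Y
    have := slayerSum_nonneg (K' - R) (K' + R) Y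
    positivity
  have hk : ∀ k ∈ S, ∑ p ∈ 𝔅, ‖(if p - k ∈ 𝔅 then 0 else zdot p (cc k) * Y (p - k) * (starRingEnd ℂ) (Y p)) +
      (if p + k ∈ 𝔅 then 0 else zdot p (EuclideanSpace.conjVec (cc k)) * Y (p + k) * (starRingEnd ℂ) (Y p))‖ ≤ 2 * L := by
    intro k hkS
    have hplus := cell_sum_boundary_le (R := R) hK hK' (m := k) (hS k hkS).1 (hS k hkS).2 (hM k) hM0 Y
    have hminus := cell_sum_boundary_le (R := R) hK hK' (m := -k) (by simpa using (hS k hkS).1)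
      (by simpa using (hS k hkS).2) (w := EuclideanSpace.conjVec (cc k))
      (by rw [EuclideanSpace.norm_conjVec]; exact hM k) hM0 Y
    simp only [sub_neg_eq_add] at hminus
    calc _ ≤ ∑ p ∈ 𝔅, ((if p - k ∈ 𝔅 then 0 else ‖zdot p (cc k) * Y (p - k) * (starRingEnd ℂ) (Y p)‖) +
          (if p + k ∈ 𝔅 then 0 else ‖zdot p (EuclideanSpace.conjVec (cc k)) * Y (p + k) * (starRingEnd ℂ) (Y p)‖)) := by
          refine Finset.sum_le_sum fun p _ => (norm_add_le _ _).trans (add_le_add ?_ ?_) <;>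
            split_ifs <;> simp
      _ ≤ L + L := by rw [Finset.sum_add_distrib]; exact add_le_add hplus hminus
      _ = 2 * L := by ring
  calc ‖bdryFlux S 𝔅 cc Y‖ ≤ ∑ p ∈ 𝔅, ∑ k ∈ S, ‖(if p - k ∈ 𝔅 then 0 else zdot p (cc k) * Y (p - k) * (starRingEnd ℂ) (Y p)) +
        (if p + k ∈ 𝔅 then 0 else zdot p (EuclideanSpace.conjVec (cc k)) * Y (p + k) * (starRingEnd ℂ) (Y p))‖ := by
        unfold bdryFlux
        exact (norm_sum_le _ _).trans (Finset.sum_le_sum fun p _ => norm_sum_le _ _)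
    _ = ∑ k ∈ S, ∑ p ∈ 𝔅, ‖(if p - k ∈ 𝔅 then 0 else zdot p (cc k) * Y (p - k) * (starRingEnd ℂ) (Y p)) +
        (if p + k ∈ 𝔅 then 0 else zdot p (EuclideanSpace.conjVec (cc k)) * Y (p + k) * (starRingEnd ℂ) (Y p))‖ :=
        Finset.sum_comm
    _ ≤ ∑ k ∈ S, 2 * L := Finset.sum_le_sum hk
    _ = 4 * S.card * M * ((K + R) * slayerSum (K - R) (K + R) Y + (K' + R) * slayerSum (K' - R) (K' + R) Y) := by
        rw [Finset.sum_const, nsmul_eq_mul, hL]; ring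

end CellFluxBound

end Summit.AnomalousDissipation.AnomalousDissipation.Theorems.ScalarAnomalySteadySourceFormal.Negative
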